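import Mathlib
import HarnessLib
import HarnessLib.Audit
import Summits.AtomisticToContinuum.Statement
import Literature.MathematicalPhysics.QuantumManyBody.PeriodicBoseGas
import HarnessLib.Audit.Status.Attr

/-!
Route: BECModePrice

# Route BECModePrice — the price of one mode — a uniform O(ρ) single-mode softening price is an
exponent-2 infrared bound, hence TL-BEC by mode counting

X = SMS ("single-mode softening"; cards price-of-one-mode = spine, freeze-one-mode-goldstone-gap =
proof road): for every repulsive
finite-range v there are C(v), ρ₀(v) such that for 0 < ρ < ρ₀, all large N, EVERY non-zero torus
momentum k = 2πp/L (L = (N/ρ)^(1/3)) and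
EVERY periodic trial state Ψ:  E₀^per(N,L) + ½|k|²·n_k(Ψ) ≤ ⟨Ψ,HΨ⟩ + C·ρ — making ONE mode
half-price lowers the N-body ground-state energy by
at most a chemical potential's worth (Bogoliubov: 0.049·8πρa), uniformly in the mode and in N. X =
ModePriceIntegrable ∧ ModePriceHardCore
(split by ∫v < ∞ / = ∞: c-number-substitution tools need v̂ bounded; hard cores need a
Dyson-softened comparison). Then PROVED-type steps:
variational chord n_k ≤ 2(Cρ+δ)/|k|² for δ-near-minimisers (an exponent-2 infrared bound whose
constant is a PRICE), the d = 3 lattice count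
Σ_(0<|k|≤K)|k|⁻² ~ KL³ with the proved crude energy bound (SofteningModeCount, DiluteEnergyBound
stmt-9011) ⇒ torus n₀ ≥ N/2, and the shared
crux BoundaryTransferWeak (stmt-0827) ⇒ the conjunct.
Lean: `ModePriceIntegrable ∧ ModePriceHardCore`

## Assembly
Pure logic (Sketch.lean rc 0, axioms propext/Classical.choice/Quot.sound): fix v repulsive
finite-range; by cases on ∫v = ⊤ the two price cruxes
give the SMS body for v; SofteningModeCount with the (proved) DiluteEnergyBound body turns it into
torus BEC of δ-near-minimisers with c = ½;
BoundaryTransferWeak concludes ∃ρ₀ ∀ρ<ρ₀ HasGroundStateBEC v ρ, i.e. the Statement decl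
`BoseEinsteinCondensation`. DECIDING THEOREM (glue.lean):
`theorem closes : ModePriceIntegrable → ModePriceHardCore → DiluteEnergyBound → SofteningModeCount →
BoundaryTransferWeak → BoseEinsteinCondensation`.

Rationale: WHY THIS LINE. Obstruction-first: every energy argument dies because de-condensing costs N/L²
(KineticGapLengthScales, EnergyAsymptoticsWithoutCondensation);
the one energy statement with O(1) rather than O(N/L²) content is a RELATIVE bound between two
variational problems on the same N-body space,
H and H − ½|k|²a†_k a_k. SMS is the single-mode remnant of the kinetic coercivity H_N − E_N ≳ θ𝒦 − C
that drives Bogoliubov theory in the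
Gross–Pitaevskii window (BoccatoEtAl2019Acta, BrenneckeCaporalettiSchlein2021; there 𝒦 = all excited
modes): in the thermodynamic limit all-mode
coercivity is FALSE (⟨𝒦⟩ is extensive), but one mode at a time the price is O(ρa) (exact two-mode
su(1,1) algebra: sup_k B(k) = 0.049μ,
B ≈ 0.19√μ|k| in the infrared, μ²/(6k²) in the ultraviolet) while the count tolerates B ≤
0.0055μ(ρa³)^(−1/2). Physical root (Nozieres1995
§1): a particle in a mode k ≠ 0 pays EXCHANGE ρv̂(k) ≈ μ against the rest and the pairing gain
saturates — diminishing returns IS the 1/k law;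
the proof road (LiebSeiringerYngvason2005's one-mode c-number substitution moved from k = 0 to k ≠
0) turns SMS into a coherent-amplitude
stiffness paid by that exchange. Imported: convex/variational analysis (Griffiths1964 chord),
coherent-state (Berezin–Lieb) sandwiches,
exponent-2 mode counting (KennedyLiebShastry1988, DysonLiebSimon1978). No listed route perturbs the
kinetic energy of a NON-zero mode:
BECRewardDescent/BECNudgeWalk reward n₀ and must walk a susceptibility to zero; BECLaplacianL1
shares the count but certifies with
‖Δγ̄‖_L¹ (a clustering statement); BECNoCheapMomentum/BECPhononFloor/BECSectorPoincareTwoScale need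
sector GAPS; Gaussian-domination routes
(BECTwoSectorGD, BECGroundStateSOS, BECThomsonPrinciple) need a particle-non-conserving
susceptibility bound.

RANKED CRUXES. #2 ModePriceIntegrable (crux) — SMS for integrable potentials (∫v(|x|)dx < ∞, bounded
v̂): ∃ C, ρ₀ with, for 0<ρ<ρ₀, eventually in N, all p ∈ ℤ³∖0 and all periodic trial states Ψ on the
torus of side (N/ρ)^(1/3): E₀^per + ½|2πp/L|²·n_p(Ψ) ≤ ⟨Ψ,HΨ⟩ + Cρ (card price-of-one-mode K1; road:
card freeze-one-mode K1+K2). [difficulty: open-problem] (why it might fail: needs inf spec(H −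
½k²a†_k a_k) ≥ E₀ − Cρ at O(1) relative precision in the TL; the mode–bath cross terms (one a_k,
three bath legs: Beliaev vertex) are ~μ√N by Cauchy–Schwarz and must be shown to average out (pair
locking); a two-phonon weight at −k softer than k³ forces C ~ log L.) [LSSY2005,
LiebSeiringerYngvason2005, Nozieres1995, BoccatoEtAl2019Acta, BrenneckeCaporalettiSchlein2021,
Griffin1993, CarlenEtAl2020]
#3 ModePriceHardCore (crux) — SMS for the non-integrable potentials of the class (hard cores v =
⊤·1_[0,a] and strongly singular cores, ∫v = ∞), same quantifiers and constant shape Cρ; the conjunct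
quantifies over them, and the c-number/Feshbach tools of the integrable case (mismatch linear in sup
v̂, empty-mode projection) are void here. [deps: ModePriceIntegrable] [difficulty: open-problem]
(why it might fail: every known one-mode tool is linear in ‖v‖₁ = ∞; projecting a mode out of (or a
plane wave into) a hard-core state costs ~n_k/a² ≫ ½k²n_k, so the price must come through a
Dyson-softened comparison potential of equal scattering length, and SMS is not monotone in v.)
[LSSY2005, LiebYngvason1998, FournaisSolovej2020, Tan2008]
#4 BoundaryTransferWeak (crux) — shared crux stmt-AtomisticToContinuum-0827 (home
BECPeriodicReduction; wanted by BECLaplacianL1, BECNoCheapMomentum, BECRewardDescent,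
BECStronglyRayleigh …), verbatim: for each repulsive finite-range v, torus BEC of δ-near-minimisers
(constant-mode occupation ≥ cN) implies ∃ρ₀ ∀ρ<ρ₀ HasGroundStateBEC v ρ (Dirichlet, λ_max via
condensateNumber). [difficulty: L] (why it might fail: torus hypothesis never fires on the Dirichlet
ground state (wall energy ≫ δ above E₀^per): no energy-comparison proof; needs Neumann bracketing of
interior sub-boxes plus a mode-free λ_max ≥ tr γ²/N — only the ENERGY is known to be
boundary-condition independent.) [LSSY2005, Junge2026, Fournais2020, ChongLiangNam2025]
#9 SofteningModeCount (support) — per potential: [SMS body for v, ∃C ρ₀ …] → [crude energy bound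
E₀^per ≤ C'ρ^(2/3)N eventually] → torus BEC with c = 1/2: chord n_p ≤ 2(Cρ+δ)/|2πp/L|² for
δ-near-minimisers (proved shape: bc birth `priceOfChord`), then `condensate_ge_half_sq` of
Theorems/BECLaplacianL1ModeCountingL1 with Cir = (Cρ+δ)L²/(2π²), UV cut κρ^(1/3)L from the energy
bound, window 26·Cir·K ≤ N/4 for ρ^(1/3) ≤ π²/(8κC(v)). [difficulty: provable-now]
[KennedyLiebShastry1988, DysonLiebSimon1978, LSSY2005]
#9 DiluteEnergyBound (support) — shared item stmt-AtomisticToContinuum-9011 (PROVED,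
diluteEnergyBound_proof): E₀^per(N,(N/ρ)^(1/3)) ≤ Cρ^(2/3)N for small ρ and large N, all admissible
v (hard cores included). [difficulty: provable-now] [LSSY2005]
#9 OneParticleAddition (support) — variational chemical-potential bound for integrable v (first
lemma of the coherent-stiffness road, card freeze-one-mode P2): adding one constant-mode particle to
an N-body (near-)minimiser costs at most Hartree + exchange ≤ 2(N+1)‖v‖₁/L³, so E₀^per(N+1,L) ≤
E₀^per(N,L) + 2(N+1)L⁻³∫v; two lines for exact eigenstates (⟨H(n₀+1)⟩ = E⟨n₀+1⟩), the variational
version needs the minimiser in the C¹ class or a limiting argument. [difficulty: M] [LSSY2005,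
LiebSeiringerYngvason2005]
#9 GPWindowModePrice (support) — SMS in the Gross–Pitaevskii window (unit torus, V_N = N²V(N·),
fixed integrable V): ∃C, eventually in N, for all p ≠ 0 and all trial states, E₀ + ½|2πp|²n_p ≤
⟨Ψ,H_NΨ⟩ + C — expected from the kinetic coercivity / a-priori bounds of the renormalised excitation
Hamiltonian (BoccatoEtAl2019Acta Thm 1.1, BrenneckeCaporalettiSchlein2021 Prop 3.4 / Thm 3.5) undone
through e^B, e^A; the special case showing that the crux is of a type that HAS been proved where a
gap is available. [difficulty: L] [BoccatoEtAl2019Acta, BrenneckeCaporalettiSchlein2021]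

TWO-LAYER PLAN. Foreseen glued splits (nothing filed now; bc/ModePriceIntegrable_birth.lean already
PROVES the glue `chord`, `priceOfChord`):
ModePriceIntegrable ⇐ SoftenedOccupationIR (phonon/crossover window |k| ≤ ρ^(1/3): bounded
occupation of the half-price mode in the
SOFTENED near-ground states) → SoftenedOccupationUV (particle window) → ModePriceIntegrable; one
level further (card freeze-one-mode):
SoftenedOccupationIR ⇐ CoherentStiffness (LSY one-mode c-number sandwich at k ≠ 0: the Landau
function G(z) of the mode's coherent amplitude is
½k²|z|²-stiff, paid by Hartree–Fock exchange because a classical mode cannot host the Goldstone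
partner at −k) → EnsembleTransfer (canonical
SMS from the grand-canonical sandwich at O(1): (N,E_N) within O(1) of the convex envelope of N′ ↦
E₀(N′,L)) → SoftenedOccupationIR; and the
dual road of card price-of-one-mode (Feshbach on the n_k-sectors: empty-mode floor p_k(1) ≤ C₁p_k(0)
+ pair locking E[n_(−k)|n_k=0] = O(1)).
ModePriceHardCore ⇐ Dyson-softened SMS at equal scattering length → comparison of the two
softened-energy infima.

KILL CRITERIA. Refuted ModePriceIntegrable (a family of trial states with ½|k|²n_k − (⟨H⟩ − E₀) → ∞
at fixed small ρ, e.g. density waves or over-squeezed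
pairs, or an ED/DMRG census showing the pair-softening price D⁻(k_min,L)/μ GROWING with L in 3-D
tori) closes the route
`refuted:ModePriceIntegrable` and is a barrier candidate ("single-mode coercivity fails in the TL")
for every exponent-2 certificate line
(BECLaplacianL1, infrared-slack-audit). Refuted only for hard cores ⇒ pivot ModePriceHardCore to an
equal-scattering-length transfer
(BECEqualScatteringTransfer's item) keeping the integrable crux. ¬BoundaryTransferWeak kills this
and every torus route at once (shared).
Growth of the price like log(L/ξ) (one-loop Beliaev weight ∝ k² instead of k³) forces a pivot to the
ε-form B = o(ρ^(2/3)) of the count, which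
survives any B = O(ρa·log); a power of L kills the line. Proved elsewhere: any exponent ≤ 2 infrared
bound with summable constant moots SMS.

NOT DECOMPOSED YET. The proof road of ModePriceIntegrable (coherent stiffness, ensemble transfer,
single-mode counting statistics) — second layer, after a
crux-ideate pass; the Bogoliubov price function B(k)/μ = √(x²+2x) − √(9x²/16+3x/2) − x/4 (x = k²/μ)
as a support computation; the constant
bookkeeping of SofteningModeCount (κ, the window ρ^(1/3) ≤ π²/(8κC)); the hard-core device (Dyson
lemma inside the softened problem); the
near-minimiser → P = 0 sector reduction (not needed: SMS is imposed on ALL trial states).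

CHEAPEST FALSIFIER. (i) Bogoliubov sandwich (pure algebra; card price-of-one-mode, rechecked): the
count needs sup_k B(k)/μ ≪ 0.0055(ρa³)^(−1/2); Bogoliubov
gives 0.0493 with Δ_k n_k ≤ B ≤ Δ_k n_k^soft = 0.0429/0.0572 — passes with parametric room. (ii)
Witness audit (KineticGapLengthScalesNarrow):
boosts (margin Nk²/2), phase/amplitude modulations (factor ≥ 2), M phonons (factor 4), number/parity
filters ((ℓ/L)³) all satisfy SMS — by hand.
(iii) This week, by a refuter: ED of the pair/single-mode softening price D⁻(k_min, L)/μ versus L at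
fixed filling on 3-D hard-core /
Bose–Hubbard tori 4³…6³ (the card's queued kit jobs j004459/j004460): growth with L kills
ModePriceIntegrable; (iv) one-loop Beliaev correction
to B(k): uniformly O(μ√(ρa³))? A log(1/kξ) demotes the constant form Cρ to the ε-form.

NUMBERS. μ = 8πρa; Bogoliubov price sup_k B(k) = 0.0493μ at k² = 0.48μ, B ≈ 0.19√μ|k| (k ≪ √μ), →
μ²/(6k²) (k ≫ √μ); Bogoliubov n_k = √μ/(2√2|k|)
in the infrared vs chord bound 0.38√μ/|k| (7 % above); pair (k,−k) softening price 0.118μ. Count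
budget (Dyson bound E₀ ≤ 4πρaN(1+o(1)),
UV cut K² = 24πρa): B ≤ π^(5/2)(52√6)⁻¹√(ρ/a) = 0.0055μ(ρa³)^(−1/2); with the crude bound E₀ ≤
Cρ^(2/3)N: B = C(v)ρ suffices once
ρ^(1/3) ≤ π²/(8κC(v)), κ² = 4(C+1). Frontier of length scales where BEC is PROVED: GP scale
a(ρa³)^(−1/2) (LSSY2005 Thm 5.1),
a(ρa³)^(−1/2−1/8+) (Fournais2020), R ∼ a(ρa³)^(−3/4−η) at T ∼ ρa (Junge2026, ChongLiangNam2025) —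
all gap-driven; here L = (N/ρ)^(1/3) → ∞ at
fixed ρ. Items at open: 8 (2 new cruxes + 1 shared crux + 4 supports + assembly).

DEFINITION REQUESTS. None blocking: PeriodicTrialState, periodicEnergy, periodicGroundStateEnergy,
cellOccupation, planeWaveMode, fracDispersion, condensateOccupation,
gpScaledPotential, sideLength, IsRepulsiveFiniteRange, HasGroundStateBEC all exist (lean search
--decl). For the second layer: bosonic Fock space
over torus modes with ONE distinguished mode, coherent vectors |z⟩_k and Berezin–Lieb upper/lower
symbols (card freeze-one-mode D1; partial
infrastructure: Literature TorusBoseFockLayer `Fock.cr/an/numberOp`, TorusFockLayer `modeAn/modeCr`)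
and the spectral projections 1(n_k = n)
of Σ_j |e_k⟩⟨e_k|_j (card price-of-one-mode D1) — to be requested when the split is filed, not now.

Novelty: Searches (2026-08-17; OpenAlex/S2/arXiv/zbMATH remote rc 3 = HTTP 429, local + galaxy used): `lit
search --hybrid "momentum distribution
single mode occupation bound interacting Bose gas ground state energy perturbation a_k† a_k
Hellmann-Feynman"` (12 books: LSSY2005, Griffin1993,
GSS1995 — none with a single-mode energy response); `lit vsearch "ground state energy decreases by
at most a bounded amount when the kinetic
energy of one momentum mode is reduced …"` (8, none); `lit galaxy search "c-number substitution"
--star all` (9: Klauder–Skagerstam, LSSY,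
Mokrzański–Napiórkowski arXiv:2410.14394, Rougerie EMS survey — zero-mode substitutions only);
`"occupation of a single momentum mode" --star all`
(1, irrelevant); `"infrared bound" --star pdf` (10: Dario–Wu Villain, Duminil-Copin — RP/classical);
`lit papers --grep Bogoliubov|Gross-Pitaevskii|
condensation` (held: arXiv:2104.13003 read Prop 3.4/Thm 3.5; arXiv:2603.20776 read pp 1–2;
arXiv:2510.20493 read p 1); pool: all 69 open
Theses grepped for softening/single-mode/price (no hit; BECBathMassLiouville's "softening" is a
density-wave m₋₁), Ideas + _closed read
(cards price-of-one-mode, freeze-one-mode-goldstone-gap: OPEN, unrouted, critic-graded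
new-combination 2026-08-16).
Nearest prior art found: LSSY2005 Thm 5.1/(5.15)–(5.17) (occupation ≤ excess energy / one-body GAP —
dies in the TL); CarlenEtAl2020 +
arXiv:2011.10869 §3.2–3.4 (Feynman–Hellmann DEFINITION of n_k via H + λN⁻¹ΣF_i inside Lieb's
simplified approach, no b  [refs: 2410.14394, 2104.13003, 2603.20776, 2510.20493, 2011.10869, LSSY2005, Griffin1993, CarlenEtAl2020, LiebSeiringerYngvason2005, KennedyLiebShastry1988, DysonLiebSimon1978, BrenneckeCaporalettiSchlein2021]

Barriers (technique_class: single-mode-energy-response, concavity-chord, mode-count): - technique_class: single-mode-energy-response, concavity-chord, mode-count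
- Literature.Barriers.AtomisticToContinuum.KineticGapLengthScales: evaded — no spectral gap of H is
used anywhere; LSSY's one-body gap |k|² (which ties L to the healing length) is replaced by the
many-body RELATIVE bound at ½|k|² with an L-independent constant; the barrier's blindness witnesses
(boosts, phase/amplitude modulations, number filters) satisfy SMS with margin ≥ 2 (audit in card,
rechecked).
- Literature.Barriers.AtomisticToContinuum.EnergyAsymptoticsWithoutCondensation: evaded in logical
type — nothing asymptotic is subtracted (E₀ appears on both sides of one inequality between two
infima on the same space); consistent with its 1-D witness: SMS is expected TRUE for Lieb–Liniger
while the count Σ|k|⁻² ~ L² fails, so SMS is not BEC restated; it DOES bite the foreseen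
EnsembleTransfer child (convexity of E(N′) at O(1)), recorded as a layer-2 crux, not assumed.
- Literature.Barriers.AtomisticToContinuum.BogoliubovPerturbationInfrared: not met head-on — nothing
is expanded around the Bogoliubov state; Bogoliubov only supplies the VALUE 0.049μ; the bet is that
the one-loop object entering the road (two-phonon weight at −k with the +k line amputated) has
non-resonant denominators; honest limit logged in ModePriceIntegrable's why-might-fail (log growth ⇒
ε-form).
- Literature.Barriers.AtomisticToContinuum.HalfFillingReflectionPositivity: evaded — no reflection
positivity, no Gaussian domination; t

History (route lifecycle, newest last):
- 2026-08-17T02:40:40Z · rev 1: restated ModePriceIntegrable (stmt-AtomisticToContinuum-18295), ModePriceHardCore (stmt-AtomisticToContinuum-18296), SofteningModeCount (stmt-AtomisticToContinuum-18297), GPWindowModePrice (stmt-AtomisticToContinuum-18300) — cone repair: restate 4 items with planeWaveMode/fracDispersion/gpScaledPotential inlined (planner-rrepair-AtomisticToContinuum-BECModePr-eb837ed9-0)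
- 2026-08-25T15:20:00Z · DORMANT — reconciler: no traction for 7.8 d (last activity item-evidence-added at 2026-08-17T19:18:15Z); parked, not closed — `ledger route dormant route-AtomisticToConti (operator:999:4192072)
- 2026-08-29T03:23:45Z · REACTIVATED — reconciler: reactivated — activity statement-checked at 2026-08-29T01:17:37Z after parking at 2026-08-25T15:20:00Z (operator:999:4185828)

sub-problem: BoseEinsteinCondensation · status: open · opened planner-plan-novel-AtomisticToContinuum-BoseEin-5b5441c9-v2-g16-0 2026-08-17T02:26:26Z · rev 1 · ledger route-AtomisticToContinuum-BECModePrice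
GENERATED by the gate from the ledger (D-0016/17). Provers cite these decls: `theorem foo : Summit.AtomisticToContinuum.BoseEinsteinCondensation.Theses.BECModePrice.<Decl> := …` in Summits/AtomisticToContinuum/BoseEinsteinCondensation/Theorems/<Name>.lean.
-/

namespace Summit.AtomisticToContinuum.BoseEinsteinCondensation.Theses.BECModePrice

open scoped BigOperators Topology Manifold Classical MeasureTheory ProbabilityTheory Matrix InnerProductSpace ComplexConjugate ContinuousMap
open Filter Set Function TopologicalSpace MeasureTheory

attribute [summit_statement] _root_.BoseEinsteinCondensation

-- earlier ModePriceIntegrable (stmt-AtomisticToContinuum-18295, replaced 2026-08-17T02:40:40Z -> stmt-AtomisticToContinuum-18512): retired by None — ∀ v : ℝ → ENNReal, Literature.MathematicalPhysics.QuantumManyBody.BoseGas.IsRepulsiveFiniteRange v → (∫⁻ x : EuclideanSpace ℝ (Fin 3), v ‖x‖) ≠ ⊤ → ∃ C : ℝ, 0 < C ∧ ∃ ρ₀ : ℝ, 0 < ρ₀ ∧ ∀ ρ : ℝ, 0 < ρ → ρ < ρ₀ → ∀ᶠ N : ℕ in Filter.atTop, ∀ p : Fin 3 → ℤ, 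
/-- item stmt-AtomisticToContinuum-18512 · crux · rank 2 · open · by planner
why it might fail: needs inf spec(H − ½k²a†_k a_k) ≥ E₀ − Cρ at O(1) relative precision in the TL; the mode–bath cross terms (one a_k, three bath legs: Beliaev vertex) are ~μ√N by Cauchy–Schwarz and must be shown to average out (pair locking); a two-phonon weight at −k softer than k³ forces C ~ log L.
sources: LSSY2005, LiebSeiringerYngvason2005, Nozieres1995, BoccatoEtAl2019Acta, BrenneckeCaporalettiSchlein2021, Griffin1993
[crux] SMS for integrable potentials (∫v(|x|)dx < ∞, bounded v̂): ∃ C, ρ₀ with, for 0<ρ<ρ₀,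
eventually in N, all p ∈ ℤ³∖0 and all periodic trial states Ψ on the torus of side (N/ρ)^(1/3):
E₀^per + ½|2πp/L|²·n_p(Ψ) ≤ ⟨Ψ,HΨ⟩ + Cρ (card price-of-one-mode K1; road: card freeze-one-mode
K1+K2). [difficulty: open-problem] [cone repair rev 1: planeWaveMode / fracDispersion 2 inlined
under `let L := sideLength ρ N` — Iff.rfl-equal to retired stmt-AtomisticToContinuum-18295 (its
evidence applies verbatim); unfold with `show`/`simp only [planeWaveMode, fracDispersion]` in
Theorems files that import PeriodicBoseGasFracEnergy.] -/
@[route_item "route-AtomisticToContinuum-BECModePrice", crux]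
def ModePriceIntegrable : Prop :=
  ∀ v : ℝ → ENNReal, Literature.MathematicalPhysics.QuantumManyBody.BoseGas.IsRepulsiveFiniteRange v → (∫⁻ x : EuclideanSpace ℝ (Fin 3), v ‖x‖) ≠ ⊤ → ∃ C : ℝ, 0 < C ∧ ∃ ρ₀ : ℝ, 0 < ρ₀ ∧ ∀ ρ : ℝ, 0 < ρ → ρ < ρ₀ → ∀ᶠ N : ℕ in Filter.atTop, ∀ p : Fin 3 → ℤ, p ≠ 0 → ∀ Ψ : Literature.MathematicalPhysics.QuantumManyBody.BoseGas.PeriodicTrialState N (Literature.MathematicalPhysics.QuantumManyBody.BoseGas.sideLength ρ N), (let L : ℝ := Literature.MathematicalPhysics.QuantumManyBody.BoseGas.sideLength ρ N; Literature.MathematicalPhysics.QuantumManyBody.BoseGas.periodicGroundStateEnergy v N L + 2⁻¹ * ENNReal.ofReal ((2 * Real.pi / L * Real.sqrt (∑ k : Fin 3, ((p k : ℤ) : ℝ) ^ 2)) ^ (2 : ℝ)) * Literature.MathematicalPhysics.QuantumManyBody.BoseGas.cellOccupation N L (fun x : EuclideanSpace ℝ (Fin 3) => ((Real.sqrt (L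 ^ 3))⁻¹ : ℂ) * Complex.exp (2 * Real.pi * Complex.I * ((∑ k : Fin 3, ((p k : ℤ) : ℝ) * x k : ℝ) : ℂ) / (L : ℂ))) Ψ.ψ ≤ Literature.MathematicalPhysics.QuantumManyBody.BoseGas.periodicEnergy v Ψ + ENNReal.ofReal (C * ρ))

-- earlier ModePriceHardCore (stmt-AtomisticToContinuum-18296, replaced 2026-08-17T02:40:40Z -> stmt-AtomisticToContinuum-18513): retired by None — ∀ v : ℝ → ENNReal, Literature.MathematicalPhysics.QuantumManyBody.BoseGas.IsRepulsiveFiniteRange v → (∫⁻ x : EuclideanSpace ℝ (Fin 3), v ‖x‖) = ⊤ → ∃ C : ℝ, 0 < C ∧ ∃ ρ₀ : ℝ, 0 < ρ₀ ∧ ∀ ρ : ℝ, 0 < ρ → ρ < ρ₀ → ∀ᶠ N : ℕ in Filter.atTop, ∀ p : Fin 3 → ℤ, p 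
/-- item stmt-AtomisticToContinuum-18513 · crux · rank 3 · open · by planner
why it might fail: every known one-mode tool is linear in ‖v‖₁ = ∞; projecting a mode out of (or a plane wave into) a hard-core state costs ~n_k/a² ≫ ½k²n_k, so the price must come through a Dyson-softened comparison potential of equal scattering length, and SMS is not monotone in v.
sources: LSSY2005, LiebYngvason1998, FournaisSolovej2020, Tan2008
[crux] SMS for the non-integrable potentials of the class (hard cores v = ⊤·1_[0,a] and strongly
singular cores, ∫v = ∞), same quantifiers and constant shape Cρ; the conjunct quantifies over them,
and the c-number/Feshbach tools of the integrable case (mismatch linear in sup v̂, empty-mode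
projection) are void here. [deps: ModePriceIntegrable] [difficulty: open-problem] [cone repair rev
1: planeWaveMode / fracDispersion 2 inlined under `let L := sideLength ρ N` — Iff.rfl-equal to
retired stmt-AtomisticToContinuum-18296 (its evidence applies verbatim); unfold with `show`/`simp
only [planeWaveMode, fracDispersion]` in Theorems files that import PeriodicBoseGasFracEnergy.] -/
@[route_item "route-AtomisticToContinuum-BECModePrice", crux]
def ModePriceHardCore : Prop :=
  ∀ v : ℝ → ENNReal, Literature.MathematicalPhysics.QuantumManyBody.BoseGas.IsRepulsiveFiniteRange v → (∫⁻ x : EuclideanSpace ℝ (Fin 3), v ‖x‖) = ⊤ → ∃ C : ℝ, 0 < C ∧ ∃ ρ₀ : ℝ, 0 < ρ₀ ∧ ∀ ρ : ℝ, 0 < ρ → ρ < ρ₀ → ∀ᶠ N : ℕ in Filter.atTop, ∀ p : Fin 3 → ℤ, p ≠ 0 → ∀ Ψ : Literature.MathematicalPhysics.QuantumManyBody.BoseGas.PeriodicTrialState N (Literature.MathematicalPhysics.QuantumManyBody.BoseGas.sideLength ρ N), (let L : ℝ := Literature.MathematicalPhysics.QuantumManyBody.BoseGas.sideLength ρ N;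 Literature.MathematicalPhysics.QuantumManyBody.BoseGas.periodicGroundStateEnergy v N L + 2⁻¹ * ENNReal.ofReal ((2 * Real.pi / L * Real.sqrt (∑ k : Fin 3, ((p k : ℤ) : ℝ) ^ 2)) ^ (2 : ℝ)) * Literature.MathematicalPhysics.QuantumManyBody.BoseGas.cellOccupation N L (fun x : EuclideanSpace ℝ (Fin 3) => ((Real.sqrt (L ^ 3))⁻¹ : ℂ) * Complex.exp (2 * Real.pi * Complex.I * ((∑ k : Fin 3, ((p k : ℤ) : ℝ) * x k : ℝ) : ℂ) / (L : ℂ))) Ψ.ψ ≤ Literature.MathematicalPhysics.QuantumManyBody.BoseGas.periodicEnergy v Ψ + ENNReal.ofReal (C * ρ))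

/-- item stmt-AtomisticToContinuum-0827 · crux · rank 4 · open · by planner
why it might fail: torus hypothesis never fires on the Dirichlet ground state (wall energy ≫ δ above E₀^per): no energy-comparison proof; needs Neumann bracketing of interior sub-boxes plus a mode-free λ_max ≥ tr γ²/N — only the ENERGY is known to be boundary-condition independent.
sources: LSSY2005, Junge2026, Fournais2020, ChongLiangNam2025
[crux] BoundaryTransferWeak (mode-free boundary-condition transfer, per potential): for each
repulsive finite-range v, PeriodicBEC(v) implies ∃ρ₀>0 ∀ρ∈(0,ρ₀) HasGroundStateBEC v ρ (Dirichlet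
ground state, λ_max(γ) ≥ cN via condensateNumber). Not glue: near-minimiser slacks are O(N/L²) while
Dirichlet/periodic energies differ by a boundary term ≫ N/L², so no energy-comparison proof;
expected route: Neumann bracketing of interior sub-boxes (−Δ_Dir ≥ ⊕−Δ_Neu, v ≥ 0) + a mode-free
criterion (λ_max ≥ tr γ²/N). Only the ENERGY analogue is in print (LiebSeiringerSolovejYngvason2005
Ch. 2 after (2.8)). v ≡ 0: hypothesis and conclusion both true. -/
@[route_item "route-AtomisticToContinuum-BECModePrice", crux]
def BoundaryTransferWeak : Prop :=
  ∀ v : ℝ → ENNReal, Literature.MathematicalPhysics.QuantumManyBody.BoseGas.IsRepulsiveFiniteRange v → (∃ ρ₀ : ℝ, 0 < ρ₀ ∧ ∀ ρ : ℝ, 0 < ρ → ρ < ρ₀ → ∃ c : ℝ, 0 < c ∧ ∀ᶠ N : ℕ in Filter.atTop, ∃ δ : ENNReal, 0 < δ ∧ ∀ Ψ : Literature.MathematicalPhysics.QuantumManyBody.BoseGas.PeriodicTrialState N (Literature.MathematicalPhysics.QuantumManyBody.BoseGas.sideLength ρ N), Literature.MathematicalPhysics.QuantumManyBody.BoseGas.periodicEnergy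 v Ψ ≤ Literature.MathematicalPhysics.QuantumManyBody.BoseGas.periodicGroundStateEnergy v N (Literature.MathematicalPhysics.QuantumManyBody.BoseGas.sideLength ρ N) + δ → ENNReal.ofReal (c * N) ≤ Literature.MathematicalPhysics.QuantumManyBody.BoseGas.condensateOccupation N (Literature.MathematicalPhysics.QuantumManyBody.BoseGas.sideLength ρ N) Ψ.ψ) → ∃ ρ₀ : ℝ, 0 < ρ₀ ∧ ∀ ρ : ℝ, 0 < ρ → ρ < ρ₀ → Literature.MathematicalPhysics.QuantumManyBody.BoseGas.HasGroundStateBEC v ρ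

/-- item stmt-AtomisticToContinuum-18298 · support · rank 9 · closed · proved by Summit.AtomisticToContinuum.BoseEinsteinCondensation.Theorems.becModePrice_diluteEnergyBound_proof @ 6badad028e81 (prover) · by planner
sources: LSSY2005
[support] shared item stmt-AtomisticToContinuum-9011 (PROVED, diluteEnergyBound_proof):
E₀^per(N,(N/ρ)^(1/3)) ≤ Cρ^(2/3)N for small ρ and large N, all admissible v (hard cores included).
[difficulty: provable-now] -/
@[route_item "route-AtomisticToContinuum-BECModePrice", crux]
def DiluteEnergyBound : Prop :=
  ∀ v : ℝ → ENNReal, Literature.MathematicalPhysics.QuantumManyBody.BoseGas.IsRepulsiveFiniteRange v → ∃ C : ℝ, 0 < C ∧ ∃ ρ₀ : ℝ, 0 < ρ₀ ∧ ∀ ρ : ℝ, 0 < ρ → ρ < ρ₀ → ∀ᶠ N : ℕ in Filter.atTop, Literature.MathematicalPhysics.QuantumManyBody.BoseGas.periodicGroundStateEnergy v N (Literature.MathematicalPhysics.QuantumManyBody.BoseGas.sideLength ρ N) ≤ ENNReal.ofReal (C * ρ ^ ((2 : ℝ) / 3) * N)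

-- `DiluteEnergyBound` holds: proved by `Summit.AtomisticToContinuum.BoseEinsteinCondensation.Theorems.becModePrice_diluteEnergyBound_proof` @ 6badad028e81 (its module imports this route file, so no `_holds` link can be stated here).

/-- item stmt-AtomisticToContinuum-18299 · support · rank 9 · open · by planner
sources: LSSY2005, LiebSeiringerYngvason2005
[support] variational chemical-potential bound for integrable v (first lemma of the
coherent-stiffness road, card freeze-one-mode P2): adding one constant-mode particle to an N-body
(near-)minimiser costs at most Hartree + exchange ≤ 2(N+1)‖v‖₁/L³, so E₀^per(N+1,L) ≤ E₀^per(N,L) +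
2(N+1)L⁻³∫v; two lines for exact eigenstates (⟨H(n₀+1)⟩ = E⟨n₀+1⟩), the variational version needs
the minimiser in the C¹ class or a limiting argument. [difficulty: M] -/
@[route_item "route-AtomisticToContinuum-BECModePrice"]
def OneParticleAddition : Prop :=
  ∀ v : ℝ → ENNReal, Literature.MathematicalPhysics.QuantumManyBody.BoseGas.IsRepulsiveFiniteRange v → (∫⁻ x : EuclideanSpace ℝ (Fin 3), v ‖x‖) ≠ ⊤ → ∃ R₀ : ℝ, (∀ r, R₀ < r → v r = 0) ∧ ∀ (N : ℕ) (L : ℝ), 1 ≤ N → 0 < L → 2 * R₀ < L → Literature.MathematicalPhysics.QuantumManyBody.BoseGas.periodicGroundStateEnergy v (N + 1) L ≤ Literature.MathematicalPhysics.QuantumManyBody.BoseGas.periodicGroundStateEnergy v N L + 2 * ((N + 1 : ℕ) : ENNReal) / ENNReal.ofReal (L ^ 3) * ∫⁻ x : EuclideanSpace ℝ (Fin 3), v ‖x‖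

-- earlier SofteningModeCount (stmt-AtomisticToContinuum-18297, replaced 2026-08-17T02:40:40Z -> stmt-AtomisticToContinuum-18514): retired by None — ∀ v : ℝ → ENNReal, Literature.MathematicalPhysics.QuantumManyBody.BoseGas.IsRepulsiveFiniteRange v → (∃ C : ℝ, 0 < C ∧ ∃ ρ₀ : ℝ, 0 < ρ₀ ∧ ∀ ρ : ℝ, 0 < ρ → ρ < ρ₀ → ∀ᶠ N : ℕ in Filter.atTop, ∀ p : Fin 3 → ℤ, p ≠ 0 → ∀ Ψ : Literature.MathematicalPhysics.Qu
/-- item stmt-AtomisticToContinuum-18514 · support · rank 9 · closed · proved by Summit.AtomisticToContinuum.BoseEinsteinCondensation.Theorems.softeningModeCount_proof @ 72e3996a6051 (prover) · by planner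
sources: KennedyLiebShastry1988, DysonLiebSimon1978, LSSY2005
[support] per potential: [SMS body for v, ∃C ρ₀ …] → [crude energy bound E₀^per ≤ C'ρ^(2/3)N
eventually] → torus BEC with c = 1/2: chord n_p ≤ 2(Cρ+δ)/|2πp/L|² for δ-near-minimisers (proved
shape: bc birth `priceOfChord`), then `condensate_ge_half_sq` of
Theorems/BECLaplacianL1ModeCountingL1 with Cir = (Cρ+δ)L²/(2π²), UV cut κρ^(1/3)L from the energy
bound, window 26·Cir·K ≤ N/4 for ρ^(1/3) ≤ π²/(8κC(v)). [difficulty: provable-now] [cone repair rev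
1: planeWaveMode / fracDispersion 2 inlined under `let L := sideLength ρ N` — Iff.rfl-equal to
retired stmt-AtomisticToContinuum-18297 (its evidence applies verbatim); unfold with `show`/`simp
only [planeWaveMode, fracDispersion]` in Theorems files that import PeriodicBoseGasFracEnergy.] -/
@[route_item "route-AtomisticToContinuum-BECModePrice", crux]
def SofteningModeCount : Prop :=
  ∀ v : ℝ → ENNReal, Literature.MathematicalPhysics.QuantumManyBody.BoseGas.IsRepulsiveFiniteRange v → (∃ C : ℝ, 0 < C ∧ ∃ ρ₀ : ℝ, 0 < ρ₀ ∧ ∀ ρ : ℝ, 0 < ρ → ρ < ρ₀ → ∀ᶠ N : ℕ in Filter.atTop, ∀ p : Fin 3 → ℤ, p ≠ 0 → ∀ Ψ : Literature.MathematicalPhysics.QuantumManyBody.BoseGas.PeriodicTrialState N (Literature.MathematicalPhysics.QuantumManyBody.BoseGas.sideLength ρ N), (let L : ℝ := Literature.MathematicalPhysics.QuantumManyBody.BoseGas.sideLength ρ N; Literature.MathematicalPhysics.QuantumManyBody.BoseGas.periodicGroundStateEnergy v N L + 2⁻¹ * ENNReal.ofReal ((2 * Real.pi / L * Real.sqrt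 (∑ k : Fin 3, ((p k : ℤ) : ℝ) ^ 2)) ^ (2 : ℝ)) * Literature.MathematicalPhysics.QuantumManyBody.BoseGas.cellOccupation N L (fun x : EuclideanSpace ℝ (Fin 3) => ((Real.sqrt (L ^ 3))⁻¹ : ℂ) * Complex.exp (2 * Real.pi * Complex.I * ((∑ k : Fin 3, ((p k : ℤ) : ℝ) * x k : ℝ) : ℂ) / (L : ℂ))) Ψ.ψ ≤ Literature.MathematicalPhysics.QuantumManyBody.BoseGas.periodicEnergy v Ψ + ENNReal.ofReal (C * ρ))) → (∃ C : ℝ, 0 < C ∧ ∃ ρ₀ : ℝ, 0 < ρ₀ ∧ ∀ ρ : ℝ, 0 < ρ → ρ < ρ₀ → ∀ᶠ N : ℕ in Filter.atTop, Literature.MathematicalPhysics.QuantumManyBody.BoseGas.periodicGroundStateEnergy v N (Literature.MathematicalPhysics.QuantumManyBody.BoseGas.sideLength ρ N) ≤ ENNReal.ofReal (C * ρ ^ ((2 : ℝ) / 3) * N)) → ∃ ρ₀ : ℝ, 0 < ρ₀ ∧ ∀ ρ : ℝ, 0 < ρ → ρ < ρ₀ → ∃ c : ℝ, 0 < c ∧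 ∀ᶠ N : ℕ in Filter.atTop, ∃ δ : ENNReal, 0 < δ ∧ ∀ Ψ : Literature.MathematicalPhysics.QuantumManyBody.BoseGas.PeriodicTrialState N (Literature.MathematicalPhysics.QuantumManyBody.BoseGas.sideLength ρ N), Literature.MathematicalPhysics.QuantumManyBody.BoseGas.periodicEnergy v Ψ ≤ Literature.MathematicalPhysics.QuantumManyBody.BoseGas.periodicGroundStateEnergy v N (Literature.MathematicalPhysics.QuantumManyBody.BoseGas.sideLength ρ N) + δ → ENNReal.ofReal (c * N) ≤ Literature.MathematicalPhysics.QuantumManyBody.BoseGas.condensateOccupation N (Literature.MathematicalPhysics.QuantumManyBody.BoseGas.sideLength ρ N) Ψ.ψ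

-- `SofteningModeCount` holds: proved by `Summit.AtomisticToContinuum.BoseEinsteinCondensation.Theorems.softeningModeCount_proof` @ 72e3996a6051 (its module imports this route file, so no `_holds` link can be stated here).

-- earlier GPWindowModePrice (stmt-AtomisticToContinuum-18300, replaced 2026-08-17T02:40:40Z -> stmt-AtomisticToContinuum-18515): retired by None — ∀ V : ℝ → ENNReal, Literature.MathematicalPhysics.QuantumManyBody.BoseGas.IsRepulsiveFiniteRange V → (∫⁻ x : EuclideanSpace ℝ (Fin 3), V ‖x‖) ≠ ⊤ → ∃ C : ℝ, 0 < C ∧ ∀ᶠ N : ℕ in Filter.atTop, ∀ p : Fin 3 → ℤ, p ≠ 0 → ∀ Ψ : Literature.MathematicalPhysics.Qu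
/-- item stmt-AtomisticToContinuum-18515 · support · rank 9 · open · by planner
sources: BoccatoEtAl2019Acta, BrenneckeCaporalettiSchlein2021
[support] SMS in the Gross–Pitaevskii window (unit torus, V_N = N²V(N·), fixed integrable V): ∃C,
eventually in N, for all p ≠ 0 and all trial states, E₀ + ½|2πp|²n_p ≤ ⟨Ψ,H_NΨ⟩ + C — expected from
the kinetic coercivity / a-priori bounds of the renormalised excitation Hamiltonian
(BoccatoEtAl2019Acta Thm 1.1, BrenneckeCaporalettiSchlein2021 Prop 3.4 / Thm 3.5) undone through
e^B, e^A; the special case showing that the crux is of a type that HAS been proved where a gap is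
available. [difficulty: L] [cone repair rev 1: gpScaledPotential (V_N r = N²V(N r)), planeWaveMode,
fracDispersion 2 inlined via `let` — Iff.rfl-equal to retired stmt-AtomisticToContinuum-18300.] -/
@[route_item "route-AtomisticToContinuum-BECModePrice"]
def GPWindowModePrice : Prop :=
  ∀ V : ℝ → ENNReal, Literature.MathematicalPhysics.QuantumManyBody.BoseGas.IsRepulsiveFiniteRange V → (∫⁻ x : EuclideanSpace ℝ (Fin 3), V ‖x‖) ≠ ⊤ → ∃ C : ℝ, 0 < C ∧ ∀ᶠ N : ℕ in Filter.atTop, ∀ p : Fin 3 → ℤ, p ≠ 0 → ∀ Ψ : Literature.MathematicalPhysics.QuantumManyBody.BoseGas.PeriodicTrialState N 1, (let VN : ℝ → ENNReal := fun r => (N : ENNReal) ^ 2 * V ((N : ℝ) * r); let L : ℝ := 1; Literature.MathematicalPhysics.QuantumManyBody.BoseGas.periodicGroundStateEnergy VN N L + 2⁻¹ * ENNReal.ofReal ((2 * Real.pi / L * Real.sqrt (∑ k : Fin 3, ((p k : ℤ) : ℝ) ^ 2)) ^ (2 : ℝ)) * Literature.MathematicalPhysics.QuantumManyBody.BoseGas.cellOccupation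 N L (fun x : EuclideanSpace ℝ (Fin 3) => ((Real.sqrt (L ^ 3))⁻¹ : ℂ) * Complex.exp (2 * Real.pi * Complex.I * ((∑ k : Fin 3, ((p k : ℤ) : ℝ) * x k : ℝ) : ℂ) / (L : ℂ))) Ψ.ψ ≤ Literature.MathematicalPhysics.QuantumManyBody.BoseGas.periodicEnergy VN Ψ + ENNReal.ofReal C)

/-- item stmt-AtomisticToContinuum-18301 · assembly · rank 1 · open · by planner
sources: LSSY2005, KennedyLiebShastry1988
[assembly] ModePriceIntegrable → ModePriceHardCore → DiluteEnergyBound → SofteningModeCount →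
BoundaryTransferWeak → BoseEinsteinCondensation. -/
@[route_item "route-AtomisticToContinuum-BECModePrice"]
def Assembly : Prop :=
  ModePriceIntegrable → ModePriceHardCore → DiluteEnergyBound → SofteningModeCount → BoundaryTransferWeak → BoseEinsteinCondensation

/-! D-0027 §2.1 — DECIDING THEOREM (planner-authored via `route open/edit --closes-file`; by planner-plan-novel-AtomisticToContinuum-BoseEin-5b5441c9-v2- 2026-08-17T02:26:26Z):
its hypotheses are this route's items and its conclusion the sub-problem Statement (glue_lint), and it elaborates with this file. -/

@[closes "route-AtomisticToContinuum-BECModePrice"] theorem closes : ModePriceIntegrable → ModePriceHardCore → DiluteEnergyBound → SofteningModeCount → BoundaryTransferWeak → BoseEinsteinCondensation := by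
  intro h1 h2 h3 h4 h5 v hv
  refine h5 v hv (h4 v hv ?_ (h3 v hv))
  by_cases h : (∫⁻ x : EuclideanSpace ℝ (Fin 3), v ‖x‖) = ⊤
  · exact h2 v hv h
  · exact h1 v hv h

end Summit.AtomisticToContinuum.BoseEinsteinCondensation.Theses.BECModePrice
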